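import Mathlib.Analysis.Convolution
import Mathlib.MeasureTheory.Integral.MeanInequalities
import HarnessLib

/-!
# Young's convolution inequality `‖k ⋆ f‖_r ≤ ‖k‖_b ‖f‖_m`, `1/b + 1/m = 1 + 1/r`

Analysis/Convolution support file (everything proved). Young's inequality for convolutions
(Robinson–Rodrigo–Sadowski 2016, Thm. A.10: "If `1 ≤ p, q, r ≤ ∞` satisfy `1 + 1/p = 1/q + 1/r`
then `‖f ⋆ g‖_{L^p} ≤ C ‖f‖_{L^q} ‖g‖_{L^r}`"; Grafakos, *Classical Fourier Analysis*, Thm. 1.2.12;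
here with the sharp-enough constant `C = 1`) for the convolution `k ⋆[lsmul ℝ ℝ, μ] f` of a real
kernel `k` with a vector-valued `f` on a measurable abelian group with an invariant measure
(`(k ⋆ f)(x) = ∫ k(y) f(x - y) dμ(y)`), in three layers:

* `lintegral_rpow_mul_rpow_mul_rpow_le` — Hölder's inequality for three functions in geometric
  form, `∫ f^p g^q h^s ≤ (∫ f)^p (∫ g)^q (∫ h)^s` for `p + q + s = 1` (Mathlib's
  `ENNReal.lintegral_prod_norm_pow_le` on `Fin 3`);
* `lintegral_sub_mul_le_young` — the pointwise step: for `ℝ≥0∞`-valued `K, Φ`, real `b, m > 0`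
  and `0 ≤ ρ ≤ 1/b, 1/m` with `1/b + 1/m - ρ = 1`,
  `∫ K(x - y) Φ(y) dy ≤ (∫ K(x - y)^b Φ(y)^m dy)^ρ (∫ K^b)^{1/b - ρ} (∫ Φ^m)^{1/m - ρ}`
  (write `KΦ = (K^bΦ^m)^ρ (K^b)^{1/b-ρ} (Φ^m)^{1/m-ρ}`), and the integrated form
  `lintegral_rpow_lintegral_sub_mul_le_young`:
  `∫ (∫ K(x - y) Φ(y) dy)^r dx ≤ (∫ K^b)^{r/b} (∫ Φ^m)^{r/m}` for `1/b + 1/m = 1 + 1/r`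
  (raise to the power `r = 1/ρ`, Tonelli, translation invariance);
* `eLpNorm_convolution_le_young` — `eLpNorm (k ⋆ f) r μ ≤ eLpNorm k b μ * eLpNorm f m μ` for
  `1 ≤ b`, `1 ≤ m`, `b⁻¹ + m⁻¹ = 1 + r⁻¹` in `ℝ≥0∞` (the case `r = ∞` is Hölder's inequality),
  and the membership corollary `memLp_convolution_young`.

The tree already has the endpoint cases `b = 1` (`Literature.Analysis.UnboundedOperators.eLpNorm_convolution_le_lintegral_enorm_mul`,
Minkowski) and `r = ∞` (`….eLpNorm_top_convolution_lsmul_le`, Hölder) and their interpolation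
(`Literature.Analysis.FunctionSpaces.exists_eLpNorm_convolution_smul_le`, kernels in `L¹ ∩ L^{m'}`);
the general case (needed for the parabolic `L^m → L^r` improvement with the heat-gradient kernel,
which is in `L^b` only for `b < 5/4`) was missing. Mathlib (this pin) has no Young inequality
beyond `L¹ × L^∞` bounds (`lean search`: `young`, `convolution.*eLpNorm`).

## References

* J. C. Robinson, J. L. Rodrigo, W. Sadowski, *The Three-Dimensional Navier–Stokes Equations*,
  CUP 2016, Thm. A.10 (p. 371). [`RobinsonRodrigoSadowskiCUP2016`]
* L. Grafakos, *Classical Fourier Analysis*, 2nd ed., GTM 249, Thm. 1.2.12.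
-/

noncomputable section

open MeasureTheory Function Filter
open scoped ENNReal NNReal Convolution

namespace Literature.Analysis.Convolution

/-! ### Hölder for three functions -/

section Holder

variable {α : Type*} [MeasurableSpace α] {μ : Measure α}

/-- **Hölder's inequality for three functions, geometric form**: for `ℝ≥0∞`-valued a.e.-measurable
`f, g, h` and real `p, q, s ≥ 0` with `p + q + s = 1`,
`∫ f^p g^q h^s ≤ (∫ f)^p (∫ g)^q (∫ h)^s`. [folklore] -/
theorem lintegral_rpow_mul_rpow_mul_rpow_le {f g h : α → ℝ≥0∞} (hf : AEMeasurable f μ)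
    (hg : AEMeasurable g μ) (hh : AEMeasurable h μ) {p q s : ℝ} (hp : 0 ≤ p) (hq : 0 ≤ q)
    (hs : 0 ≤ s) (hpqs : p + q + s = 1) :
    ∫⁻ a, f a ^ p * g a ^ q * h a ^ s ∂μ ≤
      (∫⁻ a, f a ∂μ) ^ p * (∫⁻ a, g a ∂μ) ^ q * (∫⁻ a, h a ∂μ) ^ s := by
  have key := ENNReal.lintegral_prod_norm_pow_le (μ := μ) Finset.univ (f := ![f, g, h])
    (fun i _ => by fin_cases i <;> simpa) (p := ![p, q, s])
    (by simp [Fin.sum_univ_three, hpqs]) (fun i _ => by fin_cases i <;> simpa)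
  simpa [Fin.prod_univ_three, mul_assoc] using key

/-- The algebra of the pointwise step: for `u, v ∈ ℝ≥0∞`, `b, m > 0`, `0 ≤ ρ ≤ 1/b, 1/m`,
`u v = (u^b v^m)^ρ (u^b)^{1/b - ρ} (v^m)^{1/m - ρ}`. [folklore] -/
theorem mul_eq_rpow_mul_rpow_mul_rpow (u v : ℝ≥0∞) {b m ρ : ℝ} (hb : 0 < b) (hm : 0 < m)
    (hρ : 0 ≤ ρ) (hbρ : ρ ≤ 1 / b) (hmρ : ρ ≤ 1 / m) :
    u * v = (u ^ b * v ^ m) ^ ρ * (u ^ b) ^ (1 / b - ρ) * (v ^ m) ^ (1 / m - ρ) := by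
  have hu : (u ^ b) ^ ρ * (u ^ b) ^ (1 / b - ρ) = u := by
    rw [← ENNReal.rpow_add_of_nonneg _ _ hρ (sub_nonneg.2 hbρ), add_sub_cancel,
      ← ENNReal.rpow_mul, mul_one_div_cancel hb.ne', ENNReal.rpow_one]
  have hv : (v ^ m) ^ ρ * (v ^ m) ^ (1 / m - ρ) = v := by
    rw [← ENNReal.rpow_add_of_nonneg _ _ hρ (sub_nonneg.2 hmρ), add_sub_cancel,
      ← ENNReal.rpow_mul, mul_one_div_cancel hm.ne', ENNReal.rpow_one]
  calc u * v = ((u ^ b) ^ ρ * (u ^ b) ^ (1 / b - ρ)) * ((v ^ m) ^ ρ * (v ^ m) ^ (1 / m - ρ)) := by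
        rw [hu, hv]
    _ = (u ^ b * v ^ m) ^ ρ * (u ^ b) ^ (1 / b - ρ) * (v ^ m) ^ (1 / m - ρ) := by
        rw [ENNReal.mul_rpow_of_nonneg _ _ hρ]; ring

end Holder

/-! ### The pointwise and the integrated Young inequality in `ℝ≥0∞` -/

section Lintegral

variable {G : Type*} [MeasurableSpace G] [AddCommGroup G] [MeasurableAdd₂ G] [MeasurableNeg G]
  {μ : Measure G} [SFinite μ] [μ.IsAddLeftInvariant] [μ.IsNegInvariant]

omit [SFinite μ] in
/-- **The pointwise step of Young's inequality**: for `ℝ≥0∞`-valued a.e.-measurable `K, Φ`,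
real `b, m > 0` and `0 ≤ ρ ≤ 1/b, 1/m` with `1/b + 1/m - ρ = 1`,
`∫ K(x - y) Φ(y) dy ≤ (∫ K(x - y)^b Φ(y)^m dy)^ρ (∫ K^b)^{1/b - ρ} (∫ Φ^m)^{1/m - ρ}`
(three-factor Hölder with exponents `ρ, 1/b - ρ, 1/m - ρ`; translation invariance for the middle
factor). [cite: RobinsonRodrigoSadowskiCUP2016, Thm. A.10] -/
theorem lintegral_sub_mul_le_young {K Φ : G → ℝ≥0∞} (hK : AEMeasurable K μ)
    (hΦ : AEMeasurable Φ μ) {b m ρ : ℝ} (hb : 0 < b) (hm : 0 < m) (hρ : 0 ≤ ρ)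
    (hbρ : ρ ≤ 1 / b) (hmρ : ρ ≤ 1 / m) (hsum : 1 / b + 1 / m - ρ = 1) (x : G) :
    ∫⁻ y, K (x - y) * Φ y ∂μ ≤
      (∫⁻ y, K (x - y) ^ b * Φ y ^ m ∂μ) ^ ρ * (∫⁻ y, K y ^ b ∂μ) ^ (1 / b - ρ) *
        (∫⁻ y, Φ y ^ m ∂μ) ^ (1 / m - ρ) := by
  have hmp : MeasurePreserving (fun y => x - y) μ μ := Measure.measurePreserving_sub_left μ x
  have hKx : AEMeasurable (fun y => K (x - y)) μ :=
    hK.comp_quasiMeasurePreserving hmp.quasiMeasurePreserving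
  have h1 : AEMeasurable (fun y => K (x - y) ^ b * Φ y ^ m) μ :=
    (hKx.pow_const b).mul (hΦ.pow_const m)
  have h2 : AEMeasurable (fun y => K (x - y) ^ b) μ := hKx.pow_const b
  have h3 : AEMeasurable (fun y => Φ y ^ m) μ := hΦ.pow_const m
  calc ∫⁻ y, K (x - y) * Φ y ∂μ
      = ∫⁻ y, (K (x - y) ^ b * Φ y ^ m) ^ ρ * (K (x - y) ^ b) ^ (1 / b - ρ) *
          (Φ y ^ m) ^ (1 / m - ρ) ∂μ :=
        lintegral_congr fun y => mul_eq_rpow_mul_rpow_mul_rpow _ _ hb hm hρ hbρ hmρ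
    _ ≤ (∫⁻ y, K (x - y) ^ b * Φ y ^ m ∂μ) ^ ρ * (∫⁻ y, K (x - y) ^ b ∂μ) ^ (1 / b - ρ) *
          (∫⁻ y, Φ y ^ m ∂μ) ^ (1 / m - ρ) :=
        lintegral_rpow_mul_rpow_mul_rpow_le h1 h2 h3 hρ (sub_nonneg.2 hbρ) (sub_nonneg.2 hmρ)
          (by linarith)
    _ = (∫⁻ y, K (x - y) ^ b * Φ y ^ m ∂μ) ^ ρ * (∫⁻ y, K y ^ b ∂μ) ^ (1 / b - ρ) *
          (∫⁻ y, Φ y ^ m ∂μ) ^ (1 / m - ρ) := by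
        rw [lintegral_sub_left_eq_self (fun y => K y ^ b) x]

/-- **Young's inequality in `ℝ≥0∞`, integrated form**: for `ℝ≥0∞`-valued a.e.-measurable `K, Φ`
and real exponents `1 ≤ b`, `1 ≤ m`, `0 < r` with `1/b + 1/m = 1 + 1/r`,
`∫ (∫ K(x - y) Φ(y) dy)^r dx ≤ (∫ K^b)^{r/b} (∫ Φ^m)^{r/m}` (the pointwise step raised to the
power `r`, Tonelli, and `∫ K(x - y)^b dx = ∫ K^b`). [cite: RobinsonRodrigoSadowskiCUP2016, Thm. A.10] -/
theorem lintegral_rpow_lintegral_sub_mul_le_young {K Φ : G → ℝ≥0∞} (hK : AEMeasurable K μ)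
    (hΦ : AEMeasurable Φ μ) {b m r : ℝ} (hb : 1 ≤ b) (hm : 1 ≤ m) (hr : 0 < r)
    (hbmr : 1 / b + 1 / m = 1 + 1 / r) :
    ∫⁻ x, (∫⁻ y, K (x - y) * Φ y ∂μ) ^ r ∂μ ≤
      (∫⁻ y, K y ^ b ∂μ) ^ (r / b) * (∫⁻ y, Φ y ^ m ∂μ) ^ (r / m) := by
  have hb0 : 0 < b := one_pos.trans_le hb
  have hm0 : 0 < m := one_pos.trans_le hm
  set ρ : ℝ := 1 / r with hρ_def
  have hρ0 : 0 ≤ ρ := by positivity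
  have hbinv : 1 / b ≤ 1 := (div_le_one hb0).2 hb
  have hminv : 1 / m ≤ 1 := (div_le_one hm0).2 hm
  have hbρ : ρ ≤ 1 / b := by rw [hρ_def]; linarith
  have hmρ : ρ ≤ 1 / m := by rw [hρ_def]; linarith
  have hsum : 1 / b + 1 / m - ρ = 1 := by rw [hρ_def]; linarith
  have hρr : ρ * r = 1 := by rw [hρ_def, one_div, inv_mul_cancel₀ hr.ne']
  set A : ℝ≥0∞ := ∫⁻ y, K y ^ b ∂μ with hA
  set B : ℝ≥0∞ := ∫⁻ y, Φ y ^ m ∂μ with hB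
  -- measurability on the product
  have hKprod : AEMeasurable (fun z : G × G => K (z.1 - z.2) ^ b * Φ z.2 ^ m) (μ.prod μ) :=
    ((hK.comp_quasiMeasurePreserving (quasiMeasurePreserving_sub μ μ)).pow_const b).mul
      ((hΦ.comp_quasiMeasurePreserving
        (Measure.quasiMeasurePreserving_snd (μ := μ) (ν := μ))).pow_const m)
  have hKy : ∀ y, AEMeasurable (fun x => K (x - y) ^ b) μ := fun y =>
    (hK.comp_quasiMeasurePreserving
      (measurePreserving_sub_right μ y).quasiMeasurePreserving).pow_const b
  -- the pointwise step, raised to the power `r`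
  have hpt : ∀ x, (∫⁻ y, K (x - y) * Φ y ∂μ) ^ r ≤
      (∫⁻ y, K (x - y) ^ b * Φ y ^ m ∂μ) * (A ^ (1 / b - ρ) * B ^ (1 / m - ρ)) ^ r := by
    intro x
    calc (∫⁻ y, K (x - y) * Φ y ∂μ) ^ r
        ≤ ((∫⁻ y, K (x - y) ^ b * Φ y ^ m ∂μ) ^ ρ * A ^ (1 / b - ρ) * B ^ (1 / m - ρ)) ^ r :=
          ENNReal.rpow_le_rpow (lintegral_sub_mul_le_young hK hΦ hb0 hm0 hρ0 hbρ hmρ hsum x)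
            hr.le
      _ = (∫⁻ y, K (x - y) ^ b * Φ y ^ m ∂μ) * (A ^ (1 / b - ρ) * B ^ (1 / m - ρ)) ^ r := by
          rw [mul_assoc, ENNReal.mul_rpow_of_nonneg _ _ hr.le, ← ENNReal.rpow_mul, hρr,
            ENNReal.rpow_one]
  -- Tonelli and translation invariance
  have hswap : ∫⁻ x, ∫⁻ y, K (x - y) ^ b * Φ y ^ m ∂μ ∂μ = A * B := by
    rw [lintegral_lintegral_swap hKprod]
    calc ∫⁻ y, ∫⁻ x, K (x - y) ^ b * Φ y ^ m ∂μ ∂μ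
        = ∫⁻ y, (∫⁻ x, K (x - y) ^ b ∂μ) * Φ y ^ m ∂μ := by
          refine lintegral_congr fun y => ?_
          rw [lintegral_mul_const'' _ (hKy y)]
      _ = ∫⁻ y, A * Φ y ^ m ∂μ := by
          refine lintegral_congr fun y => ?_
          rw [lintegral_sub_right_eq_self (fun x => K x ^ b) y]
      _ = A * B := by rw [lintegral_const_mul'' _ (hΦ.pow_const m)]
  -- exponent bookkeeping
  have heA : A * (A ^ (1 / b - ρ)) ^ r = A ^ (r / b) := by
    rw [← ENNReal.rpow_mul]
    conv_lhs => rw [← ENNReal.rpow_one A]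
    rw [← ENNReal.rpow_mul, one_mul, ← ENNReal.rpow_add_of_nonneg _ _ zero_le_one
      (mul_nonneg (sub_nonneg.2 hbρ) hr.le)]
    congr 1
    rw [sub_mul, hρr]; ring
  have heB : B * (B ^ (1 / m - ρ)) ^ r = B ^ (r / m) := by
    rw [← ENNReal.rpow_mul]
    conv_lhs => rw [← ENNReal.rpow_one B]
    rw [← ENNReal.rpow_mul, one_mul, ← ENNReal.rpow_add_of_nonneg _ _ zero_le_one
      (mul_nonneg (sub_nonneg.2 hmρ) hr.le)]
    congr 1
    rw [sub_mul, hρr]; ring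
  calc ∫⁻ x, (∫⁻ y, K (x - y) * Φ y ∂μ) ^ r ∂μ
      ≤ ∫⁻ x, (∫⁻ y, K (x - y) ^ b * Φ y ^ m ∂μ) * (A ^ (1 / b - ρ) * B ^ (1 / m - ρ)) ^ r ∂μ :=
        lintegral_mono fun x => hpt x
    _ = (∫⁻ x, ∫⁻ y, K (x - y) ^ b * Φ y ^ m ∂μ ∂μ) * (A ^ (1 / b - ρ) * B ^ (1 / m - ρ)) ^ r := by
        rw [lintegral_mul_const'' _ hKprod.lintegral_prod_right']
    _ = A * B * (A ^ (1 / b - ρ) * B ^ (1 / m - ρ)) ^ r := by rw [hswap]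
    _ = (A * (A ^ (1 / b - ρ)) ^ r) * (B * (B ^ (1 / m - ρ)) ^ r) := by
        rw [ENNReal.mul_rpow_of_nonneg _ _ hr.le]; ring
    _ = A ^ (r / b) * B ^ (r / m) := by rw [heA, heB]

end Lintegral

/-! ### Young's inequality for `k ⋆[lsmul ℝ ℝ] f` -/

section Young

variable {G : Type*} [MeasurableSpace G] [AddCommGroup G] [MeasurableAdd₂ G] [MeasurableNeg G]
  {μ : Measure G} [SFinite μ] [μ.IsAddLeftInvariant] [μ.IsNegInvariant]
  {F : Type*} [NormedAddCommGroup F] [NormedSpace ℝ F]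

omit [SFinite μ] in
/-- Pointwise bound in swapped form: `‖(k ⋆ f)(x)‖ ≤ ∫ |k(x - y)| ‖f(y)‖ dy`. [folklore] -/
theorem enorm_convolution_lsmul_le_lintegral_sub (k : G → ℝ) (f : G → F) (x : G) :
    ‖(k ⋆[ContinuousLinearMap.lsmul ℝ ℝ, μ] f) x‖ₑ ≤ ∫⁻ y, ‖k (x - y)‖ₑ * ‖f y‖ₑ ∂μ := by
  rw [convolution_def]
  refine (enorm_integral_le_lintegral_enorm _).trans_eq ?_
  simp_rw [ContinuousLinearMap.lsmul_apply, enorm_smul]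
  have h := lintegral_sub_left_eq_self (μ := μ) (fun t => ‖k t‖ₑ * ‖f (x - t)‖ₑ) x
  simp only [sub_sub_cancel] at h
  exact h.symm

/-- Exponent bookkeeping: `1 ≤ b`, `1 ≤ m`, `b⁻¹ + m⁻¹ = 1 + r⁻¹` in `ℝ≥0∞` with `r ≠ ∞` force
`b, m` finite, `r ≠ 0`, and the real relation `1/b + 1/m = 1 + 1/r` of the `toReal`s. [folklore] -/
theorem young_exponents_toReal {b m r : ℝ≥0∞} (hb : 1 ≤ b) (hm : 1 ≤ m)
    (hbmr : b⁻¹ + m⁻¹ = 1 + r⁻¹) (hr : r ≠ ∞) :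
    b ≠ ∞ ∧ m ≠ ∞ ∧ r ≠ 0 ∧ 1 / b.toReal + 1 / m.toReal = 1 + 1 / r.toReal := by
  have hb0 : b ≠ 0 := (zero_lt_one.trans_le hb).ne'
  have hm0 : m ≠ 0 := (zero_lt_one.trans_le hm).ne'
  have hbinv : b⁻¹ ≤ 1 := ENNReal.inv_le_one.2 hb
  have hminv : m⁻¹ ≤ 1 := ENNReal.inv_le_one.2 hm
  have hr0 : r ≠ 0 := by
    rintro rfl
    rw [ENNReal.inv_zero, add_top] at hbmr
    exact (ENNReal.add_lt_top.2 ⟨hbinv.trans_lt ENNReal.one_lt_top,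
      hminv.trans_lt ENNReal.one_lt_top⟩).ne hbmr
  have hrinv : r⁻¹ ≠ 0 := ENNReal.inv_ne_zero.2 hr
  have hbtop : b ≠ ∞ := by
    rintro rfl
    rw [ENNReal.inv_top, zero_add] at hbmr
    have : (1 : ℝ≥0∞) + r⁻¹ ≤ 1 + 0 := by rw [add_zero, ← hbmr]; exact hminv
    exact hrinv (le_antisymm ((ENNReal.add_le_add_iff_left ENNReal.one_ne_top).1 this) bot_le)
  have hmtop : m ≠ ∞ := by
    rintro rfl
    rw [ENNReal.inv_top, add_zero] at hbmr
    have : (1 : ℝ≥0∞) + r⁻¹ ≤ 1 + 0 := by rw [add_zero, ← hbmr]; exact hbinv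
    exact hrinv (le_antisymm ((ENNReal.add_le_add_iff_left ENNReal.one_ne_top).1 this) bot_le)
  refine ⟨hbtop, hmtop, hr0, ?_⟩
  have h := congrArg ENNReal.toReal hbmr
  rw [ENNReal.toReal_add (ENNReal.inv_ne_top.2 hb0) (ENNReal.inv_ne_top.2 hm0),
    ENNReal.toReal_add ENNReal.one_ne_top (ENNReal.inv_ne_top.2 hr0), ENNReal.toReal_inv,
    ENNReal.toReal_inv, ENNReal.toReal_inv, ENNReal.toReal_one] at h
  simpa only [one_div] using h

/-- **Young's convolution inequality** (Robinson–Rodrigo–Sadowski 2016, Thm. A.10, with constant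
`1`): for a real kernel `k` and a vector-valued `f` on a measurable abelian group with an
invariant measure, and exponents `1 ≤ b`, `1 ≤ m`, `b⁻¹ + m⁻¹ = 1 + r⁻¹` in `ℝ≥0∞`,
`‖k ⋆ f‖_{L^r} ≤ ‖k‖_{L^b} ‖f‖_{L^m}`. The case `r = ∞` (`b, m` conjugate) is Hölder's
inequality; for `r < ∞` it is `lintegral_rpow_lintegral_sub_mul_le_young` applied to `|k|` and
`‖f‖`. [cite: RobinsonRodrigoSadowskiCUP2016, Thm. A.10] -/
theorem eLpNorm_convolution_le_young {k : G → ℝ} (hk : AEStronglyMeasurable k μ) {f : G → F}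
    (hf : AEStronglyMeasurable f μ) {b m r : ℝ≥0∞} (hb : 1 ≤ b) (hm : 1 ≤ m)
    (hbmr : b⁻¹ + m⁻¹ = 1 + r⁻¹) :
    eLpNorm (k ⋆[ContinuousLinearMap.lsmul ℝ ℝ, μ] f) r μ ≤ eLpNorm k b μ * eLpNorm f m μ := by
  rcases eq_or_ne r ∞ with rfl | hr
  · -- Hölder
    rw [ENNReal.inv_top, add_zero] at hbmr
    haveI : b.HolderConjugate m := ⟨by rw [inv_one]; exact hbmr⟩
    rw [eLpNorm_exponent_top]
    refine eLpNormEssSup_le_of_ae_enorm_bound (Eventually.of_forall fun x => ?_)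
    have hmp : MeasurePreserving (fun y => x - y) μ μ := Measure.measurePreserving_sub_left μ x
    have hkx : AEStronglyMeasurable (fun y => k (x - y)) μ := hk.comp_measurePreserving hmp
    calc ‖(k ⋆[ContinuousLinearMap.lsmul ℝ ℝ, μ] f) x‖ₑ
        ≤ ∫⁻ y, ‖k (x - y)‖ₑ * ‖f y‖ₑ ∂μ := enorm_convolution_lsmul_le_lintegral_sub k f x
      _ = eLpNorm ((fun y => k (x - y)) • f) 1 μ := by
          rw [eLpNorm_one_eq_lintegral_enorm]
          simp_rw [Pi.smul_apply', enorm_smul]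
      _ ≤ eLpNorm (fun y => k (x - y)) b μ * eLpNorm f m μ := eLpNorm_smul_le_mul_eLpNorm hf hkx
      _ = eLpNorm k b μ * eLpNorm f m μ := by
          rw [show (fun y => k (x - y)) = k ∘ (fun y => x - y) from rfl,
            eLpNorm_comp_measurePreserving hk hmp]
  obtain ⟨hbtop, hmtop, hr0, hreal⟩ := young_exponents_toReal hb hm hbmr hr
  have hb0 : b ≠ 0 := (zero_lt_one.trans_le hb).ne'
  have hm0 : m ≠ 0 := (zero_lt_one.trans_le hm).ne'
  have hb' : 1 ≤ b.toReal := by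
    simpa using (ENNReal.toReal_le_toReal ENNReal.one_ne_top hbtop).2 hb
  have hm' : 1 ≤ m.toReal := by
    simpa using (ENNReal.toReal_le_toReal ENNReal.one_ne_top hmtop).2 hm
  have hr' : 0 < r.toReal := ENNReal.toReal_pos hr0 hr
  rw [eLpNorm_eq_lintegral_rpow_enorm_toReal hr0 hr, eLpNorm_eq_lintegral_rpow_enorm_toReal hb0 hbtop,
    eLpNorm_eq_lintegral_rpow_enorm_toReal hm0 hmtop]
  have key := lintegral_rpow_lintegral_sub_mul_le_young (μ := μ) (K := fun y => ‖k y‖ₑ)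
    (Φ := fun y => ‖f y‖ₑ) hk.enorm hf.enorm hb' hm' hr' hreal
  have hrb : r.toReal / b.toReal * (1 / r.toReal) = 1 / b.toReal := by
    field_simp
  have hrm : r.toReal / m.toReal * (1 / r.toReal) = 1 / m.toReal := by
    field_simp
  calc (∫⁻ x, ‖(k ⋆[ContinuousLinearMap.lsmul ℝ ℝ, μ] f) x‖ₑ ^ r.toReal ∂μ) ^ (1 / r.toReal)
      ≤ (∫⁻ x, (∫⁻ y, ‖k (x - y)‖ₑ * ‖f y‖ₑ ∂μ) ^ r.toReal ∂μ) ^ (1 / r.toReal) := by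
        gcongr with x
        exact enorm_convolution_lsmul_le_lintegral_sub k f x
    _ ≤ ((∫⁻ y, ‖k y‖ₑ ^ b.toReal ∂μ) ^ (r.toReal / b.toReal) *
          (∫⁻ y, ‖f y‖ₑ ^ m.toReal ∂μ) ^ (r.toReal / m.toReal)) ^ (1 / r.toReal) :=
        ENNReal.rpow_le_rpow key (by positivity)
    _ = (∫⁻ y, ‖k y‖ₑ ^ b.toReal ∂μ) ^ (1 / b.toReal) *
          (∫⁻ y, ‖f y‖ₑ ^ m.toReal ∂μ) ^ (1 / m.toReal) := by
        rw [ENNReal.mul_rpow_of_nonneg _ _ (by positivity), ← ENNReal.rpow_mul,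
          ← ENNReal.rpow_mul, hrb, hrm]

/-- **Young's inequality, membership form**: `k ∈ L^b`, `f ∈ L^m`, `1 ≤ b`, `1 ≤ m`,
`b⁻¹ + m⁻¹ = 1 + r⁻¹` imply `k ⋆ f ∈ L^r`. [cite: RobinsonRodrigoSadowskiCUP2016, Thm. A.10] -/
theorem memLp_convolution_young {k : G → ℝ} {f : G → F} {b m r : ℝ≥0∞} (hk : MemLp k b μ)
    (hf : MemLp f m μ) (hb : 1 ≤ b) (hm : 1 ≤ m) (hbmr : b⁻¹ + m⁻¹ = 1 + r⁻¹) :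
    MemLp (k ⋆[ContinuousLinearMap.lsmul ℝ ℝ, μ] f) r μ := by
  refine ⟨(hk.1.convolution_integrand (ContinuousLinearMap.lsmul ℝ ℝ) hf.1).integral_prod_right',
    ?_⟩
  refine (eLpNorm_convolution_le_young hk.1 hf.1 hb hm hbmr).trans_lt ?_
  exact ENNReal.mul_lt_top hk.eLpNorm_lt_top hf.eLpNorm_lt_top

/-- Alias of `eLpNorm_convolution_le_young` with the binder names `p, q, r`
(`p⁻¹ + q⁻¹ = 1 + r⁻¹`), kept for files written against the first version of this module.
[cite: RobinsonRodrigoSadowskiCUP2016, Thm. A.10] -/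
theorem eLpNorm_convolution_le_mul_eLpNorm {K : G → ℝ} (hK : AEStronglyMeasurable K μ)
    {f : G → F} (hf : AEStronglyMeasurable f μ) {p q r : ℝ≥0∞} (hp : 1 ≤ p) (hq : 1 ≤ q)
    (hpqr : p⁻¹ + q⁻¹ = 1 + r⁻¹) :
    eLpNorm (K ⋆[ContinuousLinearMap.lsmul ℝ ℝ, μ] f) r μ ≤ eLpNorm K p μ * eLpNorm f q μ :=
  eLpNorm_convolution_le_young hK hf hp hq hpqr

/-- Alias of `memLp_convolution_young` with the binder names `p, q, r`, kept for files written
against the first version of this module. [cite: RobinsonRodrigoSadowskiCUP2016, Thm. A.10] -/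
theorem memLp_convolution_of_memLp {K : G → ℝ} {f : G → F} {p q r : ℝ≥0∞} (hp : 1 ≤ p)
    (hq : 1 ≤ q) (hpqr : p⁻¹ + q⁻¹ = 1 + r⁻¹) (hK : MemLp K p μ) (hf : MemLp f q μ) :
    MemLp (K ⋆[ContinuousLinearMap.lsmul ℝ ℝ, μ] f) r μ :=
  memLp_convolution_young hK hf hp hq hpqr

end Young

end Literature.Analysis.Convolution
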